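import Summits.NavierStokesRegularity.FluidComputer.PalasekTowerRegisterGlobal

/-!
# REGISTER v2.3′ at a registered VISCOSITY `ν₀` — the Reynolds dial of the items of record

Cell `ns-blowup`, seat `ns-blowup-ecbridge-1` (g4); companion of `PalasekTowerRegisterGlobal.lean`
(p411629: `EpisodeBaseG` / `EpisodeInductionG`, the items of record of the route `PalasekTowerBreakdown`,
stated at UNIT viscosity) and `PalasekTowerViscosity.lean` (p404107: `Realisation.rescale`,
`palasekStep2_of_realisation`, `navierStokesBreakdownR3_of_realisation` — all viscosities). LABEL: E–C
typing (KERNEL vocabulary: the same two open `Prop`s with the viscosity as a parameter, their assembly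
and closer; every implication proved). WHAT THIS IS NOT: not Navier–Stokes evidence — nothing is
constructed or asserted; the `@[conjecture]` definitions are hypotheses of conditional theorems only;
NOT a register change (the planner owns the register; this file only makes the dial available by name).

## Why (typist K-NOTE «REYNOLDS LADDER», STATUS 2026-08-26 ≈03:13Z; HOME/ecbridge/g4/REYNOLDS-LADDER.md)

With `Schedule.Rigid` (`c₁ = 1`, `c₂ = 5/3`, windows `c₅ log N_{k+1} / A_k`) on `TowerRates.wide`, a
registered stage at viscosity `ν` has, at the point carrying the strain floor `c₁ A_k`, a structure of
width `≤ c₂ Y_k / (c₁ A_k) = (5/3)/N_k` and core-ledger circulation `≥ c₁ N_k^{β-2}`; its circulation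
Reynolds number is `Re_k = c₁ N_k^{β-2} / ν`, and its growth window lasts `c₅ log N_{k+1}` strain times
`= ν · c₅ log N_{k+1} / Re_k^{(ν=1)}`-many diffusion times of the core scale. At the items' `ν = 1`
this is the COLD ladder `Re_k = N_k^{0.3} = 5.3, 6.2, 7.5, 9.2, 11.4, …, 75 (k = 10)` with windows of
`11.7 … 2.1` core diffusion times, during which nothing may sustain the core (`push_small`:
`‖f‖ ≤ c₄ Y_k ≤ c₁ Y_k` against `ν N_k² Y_k`; `Quiet`: `f = 0` from `τ 1`). `TowerRates` has no
amplitude and `N_k = N₀^{b^k}` is not scale-covariant, so within the registered family the ONLY dial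
on the ladder is the viscosity at which the items are stated: at `ν₀` the same register reads
`Re_k = N_k^{0.3} / ν₀`, windows `= c₅ log N_{k+1}` core turnovers (unchanged) `= ν₀ · (11.7 … 2.1)`
core diffusion times. Since `PalasekStep2 R` asks a realisation at EVERY viscosity and
`Realisation.rescale` supplies all of them from one, the bridge to (C) is indifferent to `ν₀`; the
register is not (its rigid windows and unit floor constants are not rescaled along). This file states
the items with `ν₀` as a parameter — `EpisodeBaseGν ν₀`, `EpisodeInductionGν ν₀` —, recovers the items
of record at `ν₀ = 1` definitionally, and proves the assembly and the closer at every `ν₀ > 0`.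

References: S. Palasek, arXiv:2605.13827 §3–§4 [cite: Palasek2026ElementaryModel, §3–§4];
C. L. Fefferman, Clay problem description, (C) [cite: FeffermanClay2006, (C)]; T. Tao, Anal. PDE 6
(2013), Cor. 11.4 [cite: Tao2011, Cor. 11.4].
-/

noncomputable section

namespace Summit.NavierStokesRegularity.FluidComputer.PalasekTowerClayBridge

open Set MeasureTheory Filter Topology Function
open scoped ENNReal ContDiff NNReal
open Literature.Analysis.FluidPDE

/-- **K1G at viscosity `ν₀`** (open; never asserted): a pinned (`Λ = 8`, `θ = 6/5`), rigid, quiet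
schedule on the wide-base rates carries a globally anchored, strained, cored stage at level `1` AT
VISCOSITY `ν₀` (registered core Reynolds number `N₁^{β-2}/ν₀`). `EpisodeBaseGν 1` is `EpisodeBaseG`.
[cite: Palasek2026ElementaryModel, §4] -/
@[conjecture] def EpisodeBaseGν (ν₀ : ℝ) : Prop :=
  ∃ S : Schedule TowerRates.wide, S.Pins 8 (6 / 5) ∧ S.Rigid ∧ S.Quiet ∧
    Nonempty (Stage ν₀ TowerRates.wide S (Margins.routeG TowerRates.wide) 1)

/-- **K2G at viscosity `ν₀`** (open; the hard piece; never asserted): over pinned, rigid, quiet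
schedules on the wide-base rates, every globally anchored strained cored stage at level `k ≥ 1` AT
VISCOSITY `ν₀` extends to level `k + 1` (registered core Reynolds numbers `N_k^{β-2}/ν₀`, windows of
`c₅ log N_{k+1}` core turnovers). `EpisodeInductionGν 1` is `EpisodeInductionG`.
[cite: Palasek2026ElementaryModel, §4] -/
@[conjecture] def EpisodeInductionGν (ν₀ : ℝ) : Prop :=
  ∀ S : Schedule TowerRates.wide, S.Pins 8 (6 / 5) → S.Rigid → S.Quiet → ∀ k : ℕ, 1 ≤ k →
    ∀ s : Stage ν₀ TowerRates.wide S (Margins.routeG TowerRates.wide) k,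
      ∃ s' : Stage ν₀ TowerRates.wide S (Margins.routeG TowerRates.wide) (k + 1), s.Extends s'

/-- The items of record are the unit-viscosity case (definitionally). [folklore] -/
theorem episodeBaseGν_one_iff : EpisodeBaseGν 1 ↔ EpisodeBaseG := Iff.rfl

/-- The items of record are the unit-viscosity case (definitionally). [folklore] -/
theorem episodeInductionGν_one_iff : EpisodeInductionGν 1 ↔ EpisodeInductionG := Iff.rfl

/-- **K1G ∧ K2G at viscosity `ν₀` ⇒ the interface is inhabited at `ν₀`** (verbatim the unit-viscosity
assembly, which never used `ν = 1`). [cite: Palasek2026ElementaryModel, §4] -/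
theorem nonempty_realisation_of_episodesGν {ν₀ : ℝ} (h₁ : EpisodeBaseGν ν₀)
    (h₂ : EpisodeInductionGν ν₀) : Nonempty (Realisation ν₀ TowerRates.wide) := by
  obtain ⟨S, hP, hR, hQ, ⟨s₁⟩⟩ := h₁
  exact ⟨Realisation.ofEpisodes S s₁ (fun n s => h₂ S hP hR hQ (n + 1) (by omega) s)⟩

/-- K1G ∧ K2G at any viscosity `ν₀ > 0` ⇒ Palasek's Step 2 for the wide-base rates (all viscosities, by
`Realisation.rescale`). [cite: Palasek2026ElementaryModel, §4] -/
theorem palasekStep2_of_episodesGν {ν₀ : ℝ} (hν : 0 < ν₀) (h₁ : EpisodeBaseGν ν₀)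
    (h₂ : EpisodeInductionGν ν₀) : PalasekStep2 TowerRates.wide := by
  obtain ⟨W⟩ := nonempty_realisation_of_episodesGν h₁ h₂
  exact palasekStep2_of_realisation hν W

/-- **CLOSER at a registered viscosity.** K1G(ν₀) → K2G(ν₀) → W14 → Fefferman's (C), for every
`ν₀ > 0`; W14 = the Literature named fact `tao2011_forced_unconditionalUniqueness_velocity` (UNPROVED;
hypothesis) fed through `.schwartzForce`. Conditional on all three; none is asserted.
[cite: FeffermanClay2006, (C)] [cite: Tao2011, Cor. 11.4] -/
theorem navierStokesBreakdownR3_of_episodesGν {ν₀ : ℝ} (hν : 0 < ν₀) (h₁ : EpisodeBaseGν ν₀)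
    (h₂ : EpisodeInductionGν ν₀) (hU : tao2011_forced_unconditionalUniqueness_velocity) :
    Summit.NavierStokesRegularity.NavierStokesRegularity.NavierStokesBreakdownR3 :=
  navierStokesBreakdownR3_of_step2 TowerRates.wide
    (tao2011_forced_unconditionalUniqueness_velocity.schwartzForce hU)
    (palasekStep2_of_episodesGν hν h₁ h₂)

/-- **The registered core Reynolds number at viscosity `ν₀`**: `c₁ · N_k^{β-2} / ν₀` with the rigid
`c₁ = 1` — the bookkeeping quantity of the K-NOTE (circulation floor of the core ledger over the
viscosity). [folklore] -/
def coreReynolds (ν₀ : ℝ) (k : ℕ) : ℝ := TowerRates.wide.N k ^ (TowerRates.wide.β - 2) / ν₀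

/-- At unit viscosity the registered core Reynolds number is `N_k^{β-2}` — the core-ledger circulation
floor itself (`c₁ = 1`). [folklore] -/
theorem coreReynolds_one (k : ℕ) : coreReynolds 1 k = TowerRates.wide.N k ^ (TowerRates.wide.β - 2) := by
  simp [coreReynolds]

/-- The dial: the registered core Reynolds number scales like `1/ν₀`. [folklore] -/
theorem coreReynolds_eq_div (ν₀ : ℝ) (k : ℕ) : coreReynolds ν₀ k = coreReynolds 1 k / ν₀ := by
  simp [coreReynolds]

end Summit.NavierStokesRegularity.FluidComputer.PalasekTowerClayBridge

end
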